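import Summits.AtomisticToContinuum.Crystallization.Theorems.ExcessDecayLiouvilleDiscreteSobolev1D

/-!
# `ExcessDecayLiouville.HcpLiouville` (stmt-AtomisticToContinuum-9332), line `Sketch` v4: the capacity inequality on `ℕ³`

Sub-goal `blowdown_capacity` (part H1 of `stub_green`) of crux stmt-AtomisticToContinuum-9332, pure lattice half
("`ℤ³` is transient"): for a finitely supported `G` on the octant `ℕ³` with values in a real normed space, the value
at the corner is controlled by the Dirichlet energy of the cubes `Q_n = [0,n)³`,

`‖G 0‖² ≤ 196 · E`  whenever  `E_n(G) := Σ_{x ∈ Q_n} Σ_{i=1}^{3} ‖G (x + e_i) − G x‖² ≤ E` for all `n`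

(`blowdown_capacityZ3`).  Proof by dyadic cube averages `a_j := avg_{Q_{4^j}} G`: a Poincaré inequality on cubes by
axis paths (`sum_sum_norm_sub_sq_le_cube`: `Σ_{x,y ∈ Q_n} ‖G x − G y‖² ≤ 3 n⁵ E_n(G)`) and Jensen give
`‖a_j − a_{j+1}‖² ≤ 48 · 4^{-j} · E` (`norm_cubeAvg_sub_cubeAvg_sq_le`), the averages tend to `0` by finiteness of
the support, and the geometric series sums to `‖G 0‖ ≤ 14 √E`.
All `[folklore]`; a `--supports` helper for item stmt-AtomisticToContinuum-9332, nothing here closes an item.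
-/

noncomputable section

namespace Summit.AtomisticToContinuum.Crystallization.Theorems.ExcessDecayLiouville

open scoped BigOperators Topology
open Filter

/-! ## Counting identities on the cube `[0,n)³` -/

/-- Counting: a line sum in direction 1 indexed by `(x₂, x₃)`, summed over all pairs of the cube. [folklore] -/
theorem sum_cube_pair_count₁ (n : ℕ) (f : ℕ → ℕ → ℕ → ℝ) :
    ∑ x ∈ Finset.range n ×ˢ Finset.range n ×ˢ Finset.range n,
      ∑ _y ∈ Finset.range n ×ˢ Finset.range n ×ˢ Finset.range n,
        ∑ s ∈ Finset.range n, f s x.2.1 x.2.2 =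
      (n : ℝ) ^ 4 * ∑ x ∈ Finset.range n ×ˢ Finset.range n ×ˢ Finset.range n, f x.1 x.2.1 x.2.2 := by
  simp only [Finset.sum_const, Finset.card_product, Finset.card_range, Finset.sum_product, nsmul_eq_mul,
    ← Finset.mul_sum]
  have hcomm : ∑ b ∈ Finset.range n, ∑ c ∈ Finset.range n, ∑ a ∈ Finset.range n, f a b c =
      ∑ a ∈ Finset.range n, ∑ b ∈ Finset.range n, ∑ c ∈ Finset.range n, f a b c :=
    calc ∑ b ∈ Finset.range n, ∑ c ∈ Finset.range n, ∑ a ∈ Finset.range n, f a b c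
        = ∑ b ∈ Finset.range n, ∑ a ∈ Finset.range n, ∑ c ∈ Finset.range n, f a b c :=
          Finset.sum_congr rfl fun b _ => Finset.sum_comm
      _ = ∑ a ∈ Finset.range n, ∑ b ∈ Finset.range n, ∑ c ∈ Finset.range n, f a b c := Finset.sum_comm
  rw [hcomm]; push_cast; ring

/-- Counting: a line sum in direction 2 indexed by `(y₁, x₃)`, summed over all pairs of the cube. [folklore] -/
theorem sum_cube_pair_count₂ (n : ℕ) (f : ℕ → ℕ → ℕ → ℝ) :
    ∑ x ∈ Finset.range n ×ˢ Finset.range n ×ˢ Finset.range n,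
      ∑ y ∈ Finset.range n ×ˢ Finset.range n ×ˢ Finset.range n,
        ∑ s ∈ Finset.range n, f y.1 s x.2.2 =
      (n : ℝ) ^ 4 * ∑ x ∈ Finset.range n ×ˢ Finset.range n ×ˢ Finset.range n, f x.1 x.2.1 x.2.2 := by
  simp only [Finset.sum_const, Finset.card_product, Finset.card_range, Finset.sum_product, nsmul_eq_mul,
    ← Finset.mul_sum]
  have hcomm : ∑ c ∈ Finset.range n, ∑ a ∈ Finset.range n, ∑ b ∈ Finset.range n, f a b c =
      ∑ a ∈ Finset.range n, ∑ b ∈ Finset.range n, ∑ c ∈ Finset.range n, f a b c :=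
    calc ∑ c ∈ Finset.range n, ∑ a ∈ Finset.range n, ∑ b ∈ Finset.range n, f a b c
        = ∑ a ∈ Finset.range n, ∑ c ∈ Finset.range n, ∑ b ∈ Finset.range n, f a b c := Finset.sum_comm
      _ = ∑ a ∈ Finset.range n, ∑ b ∈ Finset.range n, ∑ c ∈ Finset.range n, f a b c :=
          Finset.sum_congr rfl fun a _ => Finset.sum_comm
  rw [hcomm]; push_cast; ring

/-- Counting: a line sum in direction 3 indexed by `(y₁, y₂)`, summed over all pairs of the cube. [folklore] -/
theorem sum_cube_pair_count₃ (n : ℕ) (f : ℕ → ℕ → ℕ → ℝ) :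
    ∑ _x ∈ Finset.range n ×ˢ Finset.range n ×ˢ Finset.range n,
      ∑ y ∈ Finset.range n ×ˢ Finset.range n ×ˢ Finset.range n,
        ∑ s ∈ Finset.range n, f y.1 y.2.1 s =
      (n : ℝ) ^ 4 * ∑ x ∈ Finset.range n ×ˢ Finset.range n ×ˢ Finset.range n, f x.1 x.2.1 x.2.2 := by
  simp only [Finset.sum_const, Finset.card_product, Finset.card_range, Finset.sum_product, nsmul_eq_mul,
    ← Finset.mul_sum]
  push_cast; ring

/-! ## Averages: Jensen and nested sets -/

section Averages

variable {F : Type*} [NormedAddCommGroup F] [NormedSpace ℝ F]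

/-- Jensen / Cauchy–Schwarz for an average: `‖(#s)⁻¹ • Σ_{x∈s} f x‖² ≤ (#s)⁻¹ Σ_{x∈s} ‖f x‖²`. [folklore] -/
theorem norm_avg_sq_le {ι : Type*} (s : Finset ι) (f : ι → F) :
    ‖((s.card : ℝ))⁻¹ • ∑ x ∈ s, f x‖ ^ 2 ≤ ((s.card : ℝ))⁻¹ * ∑ x ∈ s, ‖f x‖ ^ 2 := by
  rcases s.eq_empty_or_nonempty with rfl | hs
  · simp
  have hc : (0 : ℝ) < s.card := by exact_mod_cast hs.card_pos
  rw [norm_smul, norm_inv, Real.norm_natCast, mul_pow]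
  have h1 : ‖∑ x ∈ s, f x‖ ≤ ∑ x ∈ s, ‖f x‖ := norm_sum_le _ _
  have h2 : (∑ x ∈ s, ‖f x‖) ^ 2 ≤ s.card * ∑ x ∈ s, ‖f x‖ ^ 2 := sq_sum_le_card_mul_sum_sq
  have h3 : ‖∑ x ∈ s, f x‖ ^ 2 ≤ s.card * ∑ x ∈ s, ‖f x‖ ^ 2 :=
    (pow_le_pow_left₀ (norm_nonneg _) h1 2).trans h2
  calc ((s.card : ℝ))⁻¹ ^ 2 * ‖∑ x ∈ s, f x‖ ^ 2
      ≤ ((s.card : ℝ))⁻¹ ^ 2 * (s.card * ∑ x ∈ s, ‖f x‖ ^ 2) := mul_le_mul_of_nonneg_left h3 (by positivity)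
    _ = ((s.card : ℝ))⁻¹ * ∑ x ∈ s, ‖f x‖ ^ 2 := by field_simp

/-- The average of the deviations from a constant: `avg_s f − a = (#s)⁻¹ • Σ_{x∈s} (f x − a)`. [folklore] -/
theorem avg_sub_const {ι : Type*} {s : Finset ι} (hs : s.Nonempty) (f : ι → F) (a : F) :
    ((s.card : ℝ))⁻¹ • ∑ x ∈ s, f x - a = ((s.card : ℝ))⁻¹ • ∑ x ∈ s, (f x - a) := by
  have hc : (s.card : ℝ) ≠ 0 := by exact_mod_cast hs.card_pos.ne'
  rw [Finset.sum_sub_distrib, Finset.sum_const, smul_sub, ← Nat.cast_smul_eq_nsmul ℝ, smul_smul,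
    inv_mul_cancel₀ hc, one_smul]

/-- Deviation from the average is dominated by the pair differences:
`Σ_{x∈s} ‖f x − avg_s f‖² ≤ (#s)⁻¹ Σ_{x∈s} Σ_{y∈s} ‖f x − f y‖²`. [folklore] -/
theorem sum_norm_sub_avg_sq_le {ι : Type*} (s : Finset ι) (f : ι → F) :
    ∑ x ∈ s, ‖f x - ((s.card : ℝ))⁻¹ • ∑ y ∈ s, f y‖ ^ 2 ≤
      ((s.card : ℝ))⁻¹ * ∑ x ∈ s, ∑ y ∈ s, ‖f x - f y‖ ^ 2 := by
  rcases s.eq_empty_or_nonempty with rfl | hs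
  · simp
  rw [Finset.mul_sum]
  refine Finset.sum_le_sum fun x _ => ?_
  have hx : f x - ((s.card : ℝ))⁻¹ • ∑ y ∈ s, f y = ((s.card : ℝ))⁻¹ • ∑ y ∈ s, (f x - f y) := by
    have h := avg_sub_const hs (fun y => f y) (f x)
    rw [← neg_sub, h, ← smul_neg, ← Finset.sum_neg_distrib]
    simp only [neg_sub]
  rw [hx]
  exact norm_avg_sq_le s _

/-- Difference of the averages over nested sets: `‖avg_s f − avg_t f‖² ≤ (#s)⁻¹ Σ_{x∈t} ‖f x − avg_t f‖²` for
`∅ ≠ s ⊆ t`. [folklore] -/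
theorem norm_avg_sub_avg_sq_le {ι : Type*} {s t : Finset ι} (hs : s.Nonempty) (hst : s ⊆ t) (f : ι → F) :
    ‖((s.card : ℝ))⁻¹ • ∑ x ∈ s, f x - ((t.card : ℝ))⁻¹ • ∑ x ∈ t, f x‖ ^ 2 ≤
      ((s.card : ℝ))⁻¹ * ∑ x ∈ t, ‖f x - ((t.card : ℝ))⁻¹ • ∑ y ∈ t, f y‖ ^ 2 := by
  rw [avg_sub_const hs]
  refine (norm_avg_sq_le s _).trans ?_
  refine mul_le_mul_of_nonneg_left ?_ (by positivity)
  exact Finset.sum_le_sum_of_subset_of_nonneg hst fun _ _ _ => sq_nonneg _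

end Averages

/-! ## Poincaré inequality on a lattice cube -/

section Paths

variable {F : Type*} [NormedAddCommGroup F]

/-- Cauchy–Schwarz along a lattice segment: `‖g x − g y‖² ≤ n Σ_{s<n} ‖g (s+1) − g s‖²` for `x, y ≤ n`. [folklore] -/
theorem norm_sub_sq_le_mul_sum_sq (g : ℕ → F) {n x y : ℕ} (hx : x ≤ n) (hy : y ≤ n) :
    ‖g x - g y‖ ^ 2 ≤ n * ∑ s ∈ Finset.range n, ‖g (s + 1) - g s‖ ^ 2 := by
  have h1 := norm_sub_le_sum_diff g hx hy
  have h2 : (∑ s ∈ Finset.range n, ‖g (s + 1) - g s‖) ^ 2 ≤ n * ∑ s ∈ Finset.range n, ‖g (s + 1) - g s‖ ^ 2 := by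
    have := sq_sum_le_card_mul_sum_sq (s := Finset.range n) (f := fun s => ‖g (s + 1) - g s‖)
    simpa [Finset.card_range] using this
  exact (pow_le_pow_left₀ (norm_nonneg _) h1 2).trans h2

/-- The axis-path bound for a pair of points of the cube `[0,n)³`: join `x` to `y` through `(y₁,x₂,x₃)` and
`(y₁,y₂,x₃)`; each segment is bounded by the full lattice line through it. [folklore] -/
theorem norm_sub_sq_le_axis_paths (G : ℕ × ℕ × ℕ → F) {n : ℕ} {x y : ℕ × ℕ × ℕ}
    (hx : x ∈ Finset.range n ×ˢ Finset.range n ×ˢ Finset.range n)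
    (hy : y ∈ Finset.range n ×ˢ Finset.range n ×ˢ Finset.range n) :
    ‖G x - G y‖ ^ 2 ≤ 3 * n * ((∑ s ∈ Finset.range n, ‖G (s + 1, x.2.1, x.2.2) - G (s, x.2.1, x.2.2)‖ ^ 2) +
      (∑ s ∈ Finset.range n, ‖G (y.1, s + 1, x.2.2) - G (y.1, s, x.2.2)‖ ^ 2) +
      (∑ s ∈ Finset.range n, ‖G (y.1, y.2.1, s + 1) - G (y.1, y.2.1, s)‖ ^ 2)) := by
  obtain ⟨x₁, x₂, x₃⟩ := x
  obtain ⟨y₁, y₂, y₃⟩ := y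
  simp only [Finset.mem_product, Finset.mem_range] at hx hy
  have hA := norm_sub_sq_le_mul_sum_sq (fun s => G (s, x₂, x₃)) hx.1.le hy.1.le
  have hB := norm_sub_sq_le_mul_sum_sq (fun s => G (y₁, s, x₃)) hx.2.1.le hy.2.1.le
  have hC := norm_sub_sq_le_mul_sum_sq (fun s => G (y₁, y₂, s)) hx.2.2.le hy.2.2.le
  simp only at hA hB hC ⊢
  set a := ‖G (x₁, x₂, x₃) - G (y₁, x₂, x₃)‖
  set b := ‖G (y₁, x₂, x₃) - G (y₁, y₂, x₃)‖
  set c := ‖G (y₁, y₂, x₃) - G (y₁, y₂, y₃)‖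
  have htri : ‖G (x₁, x₂, x₃) - G (y₁, y₂, y₃)‖ ≤ a + b + c := by
    have hdecomp : G (x₁, x₂, x₃) - G (y₁, y₂, y₃) =
        (G (x₁, x₂, x₃) - G (y₁, x₂, x₃)) + (G (y₁, x₂, x₃) - G (y₁, y₂, x₃)) + (G (y₁, y₂, x₃) - G (y₁, y₂, y₃)) := by
      abel
    rw [hdecomp]
    exact norm_add₃_le
  have h0 : 0 ≤ ‖G (x₁, x₂, x₃) - G (y₁, y₂, y₃)‖ := norm_nonneg _
  have hsq : ‖G (x₁, x₂, x₃) - G (y₁, y₂, y₃)‖ ^ 2 ≤ 3 * (a ^ 2 + b ^ 2 + c ^ 2) := by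
    have h1 : ‖G (x₁, x₂, x₃) - G (y₁, y₂, y₃)‖ ^ 2 ≤ (a + b + c) ^ 2 := pow_le_pow_left₀ h0 htri 2
    nlinarith [sq_nonneg (a - b), sq_nonneg (a - c), sq_nonneg (b - c)]
  nlinarith [hA, hB, hC, hsq]

/-- **Poincaré inequality on a lattice cube, pair form**: `Σ_{x,y ∈ [0,n)³} ‖G x − G y‖² ≤ 3 n⁵ E_n(G)`, where
`E_n(G)` is the sum over `x ∈ [0,n)³` of the three squared forward differences at `x`. [folklore] -/
theorem sum_sum_norm_sub_sq_le_cube (G : ℕ × ℕ × ℕ → F) (n : ℕ) :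
    ∑ x ∈ Finset.range n ×ˢ Finset.range n ×ˢ Finset.range n,
      ∑ y ∈ Finset.range n ×ˢ Finset.range n ×ˢ Finset.range n, ‖G x - G y‖ ^ 2 ≤
      3 * (n : ℝ) ^ 5 * ∑ x ∈ Finset.range n ×ˢ Finset.range n ×ˢ Finset.range n,
        (‖G (x.1 + 1, x.2.1, x.2.2) - G (x.1, x.2.1, x.2.2)‖ ^ 2 +
          ‖G (x.1, x.2.1 + 1, x.2.2) - G (x.1, x.2.1, x.2.2)‖ ^ 2 +
          ‖G (x.1, x.2.1, x.2.2 + 1) - G (x.1, x.2.1, x.2.2)‖ ^ 2) := by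
  have h1 := sum_cube_pair_count₁ n (fun a b c => ‖G (a + 1, b, c) - G (a, b, c)‖ ^ 2)
  have h2 := sum_cube_pair_count₂ n (fun a b c => ‖G (a, b + 1, c) - G (a, b, c)‖ ^ 2)
  have h3 := sum_cube_pair_count₃ n (fun a b c => ‖G (a, b, c + 1) - G (a, b, c)‖ ^ 2)
  calc ∑ x ∈ Finset.range n ×ˢ Finset.range n ×ˢ Finset.range n,
        ∑ y ∈ Finset.range n ×ˢ Finset.range n ×ˢ Finset.range n, ‖G x - G y‖ ^ 2
      ≤ ∑ x ∈ Finset.range n ×ˢ Finset.range n ×ˢ Finset.range n,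
          ∑ y ∈ Finset.range n ×ˢ Finset.range n ×ˢ Finset.range n,
            3 * n * ((∑ s ∈ Finset.range n, ‖G (s + 1, x.2.1, x.2.2) - G (s, x.2.1, x.2.2)‖ ^ 2) +
              (∑ s ∈ Finset.range n, ‖G (y.1, s + 1, x.2.2) - G (y.1, s, x.2.2)‖ ^ 2) +
              (∑ s ∈ Finset.range n, ‖G (y.1, y.2.1, s + 1) - G (y.1, y.2.1, s)‖ ^ 2)) :=
        Finset.sum_le_sum fun x hx => Finset.sum_le_sum fun y hy => norm_sub_sq_le_axis_paths G hx hy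
    _ = 3 * n * ((n : ℝ) ^ 4 * ∑ x ∈ Finset.range n ×ˢ Finset.range n ×ˢ Finset.range n,
            ‖G (x.1 + 1, x.2.1, x.2.2) - G (x.1, x.2.1, x.2.2)‖ ^ 2 +
          (n : ℝ) ^ 4 * ∑ x ∈ Finset.range n ×ˢ Finset.range n ×ˢ Finset.range n,
            ‖G (x.1, x.2.1 + 1, x.2.2) - G (x.1, x.2.1, x.2.2)‖ ^ 2 +
          (n : ℝ) ^ 4 * ∑ x ∈ Finset.range n ×ˢ Finset.range n ×ˢ Finset.range n,
            ‖G (x.1, x.2.1, x.2.2 + 1) - G (x.1, x.2.1, x.2.2)‖ ^ 2) := by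
        rw [← h1, ← h2, ← h3]
        simp only [Finset.mul_sum, Finset.sum_add_distrib, mul_add]
    _ = _ := by
        rw [Finset.sum_add_distrib, Finset.sum_add_distrib]; ring

end Paths

section TwoCubes

variable {F : Type*} [NormedAddCommGroup F] [NormedSpace ℝ F]

/-- **Averages over nested cubes**: for `0 < m ≤ n`,
`‖avg_{Q_m} G − avg_{Q_n} G‖² ≤ (m³)⁻¹ · 3 n² · E_n(G)`. [folklore] -/
theorem norm_cubeAvg_sub_cubeAvg_sq_le (G : ℕ × ℕ × ℕ → F) {m n : ℕ} (hm : 0 < m) (hmn : m ≤ n) :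
    ‖((m : ℝ) ^ 3)⁻¹ • ∑ x ∈ Finset.range m ×ˢ Finset.range m ×ˢ Finset.range m, G x -
        ((n : ℝ) ^ 3)⁻¹ • ∑ x ∈ Finset.range n ×ˢ Finset.range n ×ˢ Finset.range n, G x‖ ^ 2 ≤
      ((m : ℝ) ^ 3)⁻¹ * (3 * (n : ℝ) ^ 2 * ∑ x ∈ Finset.range n ×ˢ Finset.range n ×ˢ Finset.range n,
        (‖G (x.1 + 1, x.2.1, x.2.2) - G (x.1, x.2.1, x.2.2)‖ ^ 2 +
          ‖G (x.1, x.2.1 + 1, x.2.2) - G (x.1, x.2.1, x.2.2)‖ ^ 2 +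
          ‖G (x.1, x.2.1, x.2.2 + 1) - G (x.1, x.2.1, x.2.2)‖ ^ 2)) := by
  have hn : 0 < n := hm.trans_le hmn
  have hcm : (((Finset.range m ×ˢ Finset.range m ×ˢ Finset.range m).card : ℕ) : ℝ) = (m : ℝ) ^ 3 := by
    simp only [Finset.card_product, Finset.card_range]; push_cast; ring
  have hcn : (((Finset.range n ×ˢ Finset.range n ×ˢ Finset.range n).card : ℕ) : ℝ) = (n : ℝ) ^ 3 := by
    simp only [Finset.card_product, Finset.card_range]; push_cast; ring
  have hne : (Finset.range m ×ˢ Finset.range m ×ˢ Finset.range m).Nonempty := by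
    simp only [Finset.nonempty_product, Finset.nonempty_range_iff]
    exact ⟨hm.ne', hm.ne', hm.ne'⟩
  have hsub : Finset.range m ×ˢ Finset.range m ×ˢ Finset.range m ⊆ Finset.range n ×ˢ Finset.range n ×ˢ Finset.range n :=
    Finset.product_subset_product (Finset.range_mono hmn)
      (Finset.product_subset_product (Finset.range_mono hmn) (Finset.range_mono hmn))
  have h1 := norm_avg_sub_avg_sq_le hne hsub G
  have h2 := sum_norm_sub_avg_sq_le (Finset.range n ×ˢ Finset.range n ×ˢ Finset.range n) G
  have h3 := sum_sum_norm_sub_sq_le_cube G n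
  rw [hcm, hcn] at h1
  rw [hcn] at h2
  refine h1.trans (mul_le_mul_of_nonneg_left (h2.trans ?_) (by positivity))
  have hn3 : (0 : ℝ) < (n : ℝ) ^ 3 := by positivity
  rw [inv_mul_le_iff₀ hn3]
  refine h3.trans (le_of_eq ?_)
  ring

end TwoCubes

/-! ## The capacity inequality -/

section Capacity

variable {F : Type*} [NormedAddCommGroup F] [NormedSpace ℝ F]

/-- **Capacity inequality on `ℕ³`** (general normed space): `‖G 0‖² ≤ 196 · E` if all cube energies are `≤ E` and
`G` is finitely supported. [folklore] -/
theorem norm_corner_sq_le_of_cubeEnergy_le (G : ℕ × ℕ × ℕ → F) (hG : (Function.support G).Finite) {E : ℝ}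
    (hE : ∀ n : ℕ, ∑ x ∈ Finset.range n ×ˢ Finset.range n ×ˢ Finset.range n,
        (‖G (x.1 + 1, x.2.1, x.2.2) - G (x.1, x.2.1, x.2.2)‖ ^ 2 +
          ‖G (x.1, x.2.1 + 1, x.2.2) - G (x.1, x.2.1, x.2.2)‖ ^ 2 +
          ‖G (x.1, x.2.1, x.2.2 + 1) - G (x.1, x.2.1, x.2.2)‖ ^ 2) ≤ E) :
    ‖G (0, 0, 0)‖ ^ 2 ≤ 196 * E := by
  classical
  have hE0 : 0 ≤ E := by simpa using hE 0
  -- the dyadic averages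
  obtain ⟨a, ha⟩ : ∃ a : ℕ → F, ∀ j, a j = (((4 : ℝ) ^ j) ^ 3)⁻¹ •
      ∑ x ∈ Finset.range (4 ^ j) ×ˢ Finset.range (4 ^ j) ×ˢ Finset.range (4 ^ j), G x := ⟨_, fun _ => rfl⟩
  have ha0 : a 0 = G (0, 0, 0) := by
    rw [ha]; simp
  -- consecutive averages
  have hstep : ∀ j : ℕ, dist (a j) (a (j + 1)) ≤ 14 * Real.sqrt E / 2 / 2 ^ j := by
    intro j
    have hm : 0 < 4 ^ j := pow_pos (by norm_num) j
    have hmn : 4 ^ j ≤ 4 ^ (j + 1) := Nat.pow_le_pow_right (by norm_num) (Nat.le_succ j)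
    have h := norm_cubeAvg_sub_cubeAvg_sq_le G hm hmn
    push_cast at h
    rw [← ha, ← ha] at h
    have hs : (0 : ℝ) < (4 : ℝ) ^ j := by positivity
    have h2j : ((2 : ℝ) ^ j) ^ 2 = (4 : ℝ) ^ j := by
      rw [← pow_mul, mul_comm, pow_mul]; norm_num
    have hR : (14 * Real.sqrt E / 2 / 2 ^ j) ^ 2 = 49 * E / (4 : ℝ) ^ j := by
      rw [div_pow, div_pow, mul_pow, Real.sq_sqrt hE0, h2j]; ring
    have hsq : dist (a j) (a (j + 1)) ^ 2 ≤ (14 * Real.sqrt E / 2 / 2 ^ j) ^ 2 := by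
      rw [hR, dist_eq_norm]
      refine h.trans ?_
      rw [pow_succ]
      calc (((4 : ℝ) ^ j) ^ 3)⁻¹ * (3 * ((4 : ℝ) ^ j * 4) ^ 2 * _)
          ≤ (((4 : ℝ) ^ j) ^ 3)⁻¹ * (3 * ((4 : ℝ) ^ j * 4) ^ 2 * E) := by gcongr; exact hE _
        _ = 48 * E / (4 : ℝ) ^ j := by field_simp; ring
        _ ≤ 49 * E / (4 : ℝ) ^ j := by gcongr; linarith
    exact (sq_le_sq₀ dist_nonneg (by positivity)).1 hsq
  -- the averages tend to zero
  have htend : Tendsto a atTop (𝓝 0) := by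
    set M : ℝ := ∑ x ∈ hG.toFinset, ‖G x‖ with hM
    have hbound : ∀ J : ℕ, ‖a J‖ ≤ M * (1 / 4 : ℝ) ^ J := by
      intro J
      rw [ha, norm_smul, norm_inv, norm_pow, norm_pow, Real.norm_ofNat]
      have hsum : ‖∑ x ∈ Finset.range (4 ^ J) ×ˢ Finset.range (4 ^ J) ×ˢ Finset.range (4 ^ J), G x‖ ≤ M := by
        refine (norm_sum_le _ _).trans ?_
        calc ∑ x ∈ Finset.range (4 ^ J) ×ˢ Finset.range (4 ^ J) ×ˢ Finset.range (4 ^ J), ‖G x‖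
            ≤ ∑ x ∈ Finset.range (4 ^ J) ×ˢ Finset.range (4 ^ J) ×ˢ Finset.range (4 ^ J) ∪ hG.toFinset, ‖G x‖ :=
              Finset.sum_le_sum_of_subset_of_nonneg Finset.subset_union_left fun _ _ _ => norm_nonneg _
          _ = M := by
              rw [hM]
              refine (Finset.sum_subset Finset.subset_union_right fun x _ hx => ?_).symm
              rw [Set.Finite.mem_toFinset, Function.mem_support, not_not] at hx
              rw [hx, norm_zero]
      have hM0 : 0 ≤ M := Finset.sum_nonneg fun _ _ => norm_nonneg _
      have hinv : (((4 : ℝ) ^ J) ^ 3)⁻¹ ≤ (1 / 4 : ℝ) ^ J := by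
        rw [one_div_pow, one_div]
        refine inv_anti₀ (by positivity) ?_
        exact le_self_pow₀ (one_le_pow₀ (by norm_num)) (by norm_num)
      calc (((4 : ℝ) ^ J) ^ 3)⁻¹ * ‖∑ x ∈ Finset.range (4 ^ J) ×ˢ Finset.range (4 ^ J) ×ˢ Finset.range (4 ^ J), G x‖
          ≤ (1 / 4 : ℝ) ^ J * M := mul_le_mul hinv hsum (norm_nonneg _) (by positivity)
        _ = M * (1 / 4 : ℝ) ^ J := mul_comm _ _
    refine squeeze_zero_norm hbound ?_
    simpa using (tendsto_pow_atTop_nhds_zero_of_lt_one (by norm_num : (0 : ℝ) ≤ 1 / 4)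
      (by norm_num : (1 / 4 : ℝ) < 1)).const_mul M
  have hmain := dist_le_of_le_geometric_two_of_tendsto₀ hstep htend
  rw [dist_zero_right, ha0] at hmain
  calc ‖G (0, 0, 0)‖ ^ 2 ≤ (14 * Real.sqrt E) ^ 2 := pow_le_pow_left₀ (norm_nonneg _) hmain 2
    _ = 196 * E := by rw [mul_pow, Real.sq_sqrt hE0]; norm_num

end Capacity

/-- **Capacity inequality on `ℕ³`** ("`ℤ³` is transient"), registered form for `E3`-valued fields: for a finitely
supported `G : ℕ³ → E3` whose cube Dirichlet energies are all `≤ E`, `‖G 0‖² ≤ 196 · E`. [folklore] -/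
theorem blowdown_capacityZ3 : ∀ (G : ℕ × ℕ × ℕ → EuclideanSpace ℝ (Fin 3)) (E : ℝ), (Function.support G).Finite →
    (∀ n : ℕ, ∑ x ∈ Finset.range n ×ˢ Finset.range n ×ˢ Finset.range n,
        (‖G (x.1 + 1, x.2.1, x.2.2) - G (x.1, x.2.1, x.2.2)‖ ^ 2 +
          ‖G (x.1, x.2.1 + 1, x.2.2) - G (x.1, x.2.1, x.2.2)‖ ^ 2 +
          ‖G (x.1, x.2.1, x.2.2 + 1) - G (x.1, x.2.1, x.2.2)‖ ^ 2) ≤ E) →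
    ‖G (0, 0, 0)‖ ^ 2 ≤ 196 * E :=
  fun G _ hG hE => norm_corner_sq_le_of_cubeEnergy_le G hG hE

end Summit.AtomisticToContinuum.Crystallization.Theorems.ExcessDecayLiouville

end
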